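import Mathlib.Data.Nat.Factorial.Basic
import Mathlib.Data.Real.Basic
import HarnessLib

/-!
# Hara–Hattori–Watanabe 2001, Theorem 2.2: the certificate (integer enclosure recursion) and its evaluation

Hara–Hattori–Watanabe, *Triviality of hierarchical Ising model in four dimensions*, CMP 220 (2001)
13–40, prove their Theorem 2.2 (vendored as the named fact
`Literature.Barriers.CriticalPhenomena.HaraHattoriWatanabe2001_thm22`) by a computer-aided two-sided
evaluation (§5.3, 70-digit interval arithmetic) of the Taylor coefficients
`a_{n,N}`, `ĥ_N(ξ) = Σ_n (-1)ⁿ a_{n,N} ξ^{2n}/n!` ((5.1)) of the characteristic functions along the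
trajectory, via the truncated recursion of Proposition 5.1 ((5.8)–(5.14)) for `N ≤ N₁ = 100`,
`n ≤ M`, at the two parameter values `s₋ = 1.7925671170092624`, `s₊ = 1.7925671170092625`, followed
by the six inequalities (5.30)–(5.33).

This file is the COMPUTATION, redone as a self-contained integer certificate that the Lean kernel
(or compiler) evaluates: every real bound is a natural number `X` meaning `X / 2^P`; lower bounds
are rounded down, upper bounds up; `√2 ∈ [s2L, s2L+1]/2^P` is validated by squaring; the
truncation tails are the finite/geometric majorants described at `bHi`, `tail` (a re-derivation of
Proposition 5.1 using only `a_{n,N} ≥ 0` and Newman's inequality (A.6) `a_{m+n} ≤ a_m a_n`, whose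
special case is (5.3) `a_n ≤ a_1ⁿ`). `check C = true` asserts: both runs stayed well-defined (every
geometric ratio `< 1`, every normalisation `ã₀ > 0`) and the final inequalities hold in the
cross-multiplied integer forms listed at `chk217`, `chk530`, `chkN0` — (2.17) for `70 ≤ N < 100`, `μ_{2,100}(s₋) < 1`,
`μ_{2,100}(s₊) > 1 + (3/√2) μ̄_{4,100}(s₊)` ((5.30)), and the endpoint-mixed forms (5.34) of
(2.14)–(2.16) at `N₀ = 70` including the signs `0 ≤ μ₄`, `0 ≤ μ₈`.

The MEANING of `check = true` for real sequences (the soundness theorem = Proposition 5.1 for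
abstract coefficient families; the enclosure invariant `Encl` and the proof-side `run` are declared
here) is in the sibling files `…Thm22CertObjects|Arith|Tail|Step|Sound`, and the assembly of
Theorem 2.2 from it and the analytic inputs ((5.4)–(5.7), (A.6), monotonicity in `s`) is
`…Thm22OfParts`. Reference semantics and calibration: the Python prototype reproduces every digit
printed on p. 20 of the paper (`μ̄₄,₇₀ ≤ 0.004144`, `3.6459`, `3.7542`, `38.488`, the 44-digit
enclosures of `μ_{2,100}(s±)`); with `M = 60`, `P = 330` the enclosure widths are `≈ 4·10⁻¹⁹` at
`N = 100`.

Design: plain structural recursion on `ℕ`/`List ℕ`, binomials by `descFactorial / factorial` (the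
Pascal recursion of `Nat.choose` is exponential under evaluation), no well-founded recursion, no
`Nat.sqrt` (the root is a validated literal), tables built once (`Tab`).
-/

namespace Literature.Barriers.CriticalPhenomena.HierarchicalRG.Thm22Cert

/-- Ceiling division `⌈x / y⌉` (for `y > 0`). [folklore] -/
def cdiv (x y : ℕ) : ℕ := (x + y - 1) / y

/-- `Σ_{i < k} f i` by structural recursion (kernel-friendly `Finset.sum (range k)`). [folklore] -/
def nsum (f : ℕ → ℕ) : ℕ → ℕ
  | 0 => 0
  | k + 1 => nsum f k + f k

/-- List access with default `0`. [folklore] -/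
def get (l : List ℕ) (i : ℕ) : ℕ := l.getD i 0

/-- Nested list access with default `0`. [folklore] -/
def get2 (l : List (List ℕ)) (i j : ℕ) : ℕ := (l.getD i []).getD j 0

/-- `wnum n m = 2^m ∏_{i=1}^{m} (2n+2i-1)`, so that the weight of (5.6),
`w(n,m) = (2m+2n)! n! / (m! (m+n)! (2n)!)`, equals `wnum n m / m!`.
[cite: HaraHattoriWatanabe2001, §5.1 eq. (5.6)] -/
def wnum (n : ℕ) : ℕ → ℕ
  | 0 => 1
  | m + 1 => wnum n m * (2 * (2 * n + 2 * m + 1))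

/-- Binomial coefficient by the multiplicative formula `n^{(k)}/k!` (evaluation-friendly). [folklore] -/
def binom (n k : ℕ) : ℕ := n.descFactorial k / k.factorial

/-- Parameters of a certificate run: truncation order `M` (coefficients `a_0 … a_M` are enclosed),
precision `P` (fixed point `2^P`), a candidate `s2L = ⌊√2·2^P⌋` (validated by `sqrtOK`), the
number of RG steps `nSteps` (`N₁ = 100`) and the test step `N0` (`N₀ = 70`).
[cite: HaraHattoriWatanabe2001, Theorem 2.2 and Proposition 5.1] -/
structure Cfg where
  /-- truncation order `M` -/
  M : ℕ
  /-- bits of precision -/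
  P : ℕ
  /-- candidate `⌊√2 · 2^P⌋` -/
  s2L : ℕ
  /-- number of renormalisation steps (`N₁`) -/
  nSteps : ℕ
  /-- the step `N₀` at which (2.14)–(2.16) are tested -/
  N0 : ℕ

namespace Cfg

variable (C : Cfg)

/-- The fixed-point unit `2^P`. [folklore] -/
def one : ℕ := 2 ^ C.P
/-- Upper candidate for `√2 · 2^P`. [folklore] -/
def s2H : ℕ := C.s2L + 1
/-- Validation of the square-root literal: `s2L² ≤ 2·4^P < (s2L+1)²`. [folklore] -/
def sqrtOK : Bool := decide (C.s2L * C.s2L ≤ 2 * C.one * C.one) && decide (2 * C.one * C.one < C.s2H * C.s2H)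
/-- Lower fixed-point bound of `β = 1/√2 - 1/2 = √2/2 - 1/2` ((1.1) at `c = √2`).
[cite: HaraHattoriWatanabe2001, §1 eq. (1.1)] -/
def betL : ℕ := (C.s2L - C.one) / 2
/-- Upper fixed-point bound of `β`. [cite: HaraHattoriWatanabe2001, §1 eq. (1.1)] -/
def betH : ℕ := cdiv (C.s2H - C.one) 2
/-- Upper fixed-point bound of `βc = β√2`. [cite: HaraHattoriWatanabe2001, §5.2 eq. (5.15)] -/
def rH : ℕ := cdiv (C.betH * C.s2H) C.one
/-- Upward-rounded fixed-point product. [folklore] -/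
def mulH (x y : ℕ) : ℕ := cdiv (x * y) C.one
/-- `⌊(c/4)ⁿ 2^P⌋`-type lower bound of `(√2/4)ⁿ` (one rounding of an exact rational). [folklore] -/
def c4L (n : ℕ) : ℕ := C.s2L ^ n * C.one / 2 ^ ((C.P + 2) * n)
/-- Upper bound of `(√2/4)ⁿ`. [folklore] -/
def c4H (n : ℕ) : ℕ := cdiv (C.s2H ^ n * C.one) (2 ^ ((C.P + 2) * n))
/-- Lower bound of `w(n,m) (β/2)^m` (weights of (5.6)). [cite: HaraHattoriWatanabe2001, §5.1 eq. (5.6)] -/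
def wbL (n m : ℕ) : ℕ := wnum n m * C.betL ^ m * C.one / (m.factorial * 2 ^ ((C.P + 1) * m))
/-- Upper bound of `w(n,m) (β/2)^m`. [cite: HaraHattoriWatanabe2001, §5.1 eq. (5.6)] -/
def wbH (n m : ℕ) : ℕ := cdiv (wnum n m * C.betH ^ m * C.one) (m.factorial * 2 ^ ((C.P + 1) * m))
/-- Upper bound of `w(n,m) (β/2)^m (c/2)^{m+n}` (tail weights, cf. (5.26)).
[cite: HaraHattoriWatanabe2001, §5.2 eq. (5.26)] -/
def twH (n m : ℕ) : ℕ :=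
  cdiv (wnum n m * C.betH ^ m * C.s2H ^ (m + n) * C.one)
    (m.factorial * 2 ^ ((C.P + 1) * m) * 2 ^ ((C.P + 1) * (m + n)))
/-- Lower initial value `⌊a_{n,0} 2^P⌋`, `a_{n,0} = n! s^{2n}/(2n)!`, `s = sNum/10¹⁶` ((5.2)).
[cite: HaraHattoriWatanabe2001, §5.1 eq. (5.2)] -/
def initLo (sNum n : ℕ) : ℕ := n.factorial * sNum ^ (2 * n) * C.one / ((2 * n).factorial * 10 ^ (32 * n))
/-- Upper initial value `⌈a_{n,0} 2^P⌉` ((5.2)). [cite: HaraHattoriWatanabe2001, §5.1 eq. (5.2)] -/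
def initHi (sNum n : ℕ) : ℕ := cdiv (n.factorial * sNum ^ (2 * n) * C.one) ((2 * n).factorial * 10 ^ (32 * n))

end Cfg

/-- The constant tables of a run (binomials, powers of `c/4`, weights), built once.
[cite: HaraHattoriWatanabe2001, §5.1 eqs. (5.4), (5.6)] -/
structure Tab where
  /-- `binom n l`, `n ≤ 2M` -/
  binom : List (List ℕ)
  /-- `c4L n`, `n ≤ 2M` -/
  c4L : List ℕ
  /-- `c4H n`, `n ≤ 2M` -/
  c4H : List ℕ
  /-- `wbL n m`, `n ≤ M`, `m ≤ 2M - n` -/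
  wbL : List (List ℕ)
  /-- `wbH n m` -/
  wbH : List (List ℕ)
  /-- `twH n m` for `m = 2M-n+1 … 3M+1`, stored at index `m - (2M-n+1)` -/
  twH : List (List ℕ)

/-- `s₋ = 1.7925671170092624` as an integer numerator over `10¹⁶`.
[cite: HaraHattoriWatanabe2001, Theorem 2.2] -/
def sMinusNum : ℕ := 17925671170092624
/-- `s₊ = 1.7925671170092625` over `10¹⁶`. [cite: HaraHattoriWatanabe2001, Theorem 2.2] -/
def sPlusNum : ℕ := 17925671170092625

namespace Cfg

variable (C : Cfg)

/-- Build the tables. [cite: HaraHattoriWatanabe2001, §5.1 eqs. (5.4), (5.6)] -/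
def mkTab : Tab where
  binom := (List.range (2 * C.M + 1)).map fun n => (List.range (n + 1)).map (binom n)
  c4L := (List.range (2 * C.M + 1)).map C.c4L
  c4H := (List.range (2 * C.M + 1)).map C.c4H
  wbL := (List.range (C.M + 1)).map fun n => (List.range (2 * C.M + 1 - n)).map (C.wbL n)
  wbH := (List.range (C.M + 1)).map fun n => (List.range (2 * C.M + 1 - n)).map (C.wbH n)
  twH := (List.range (C.M + 1)).map fun n =>
    (List.range (C.M + n + 1)).map fun j => C.twH n (2 * C.M + 1 - n + j)

/-- The lower enclosure extended by `0` beyond `M` (`a_l ≥ 0`). [cite: HaraHattoriWatanabe2001, §5.2 eq. (5.8)] -/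
def loExt (lo : List ℕ) (l : ℕ) : ℕ := if l ≤ C.M then get lo l else 0

/-- The upper enclosure extended beyond `M` through Newman's inequality (A.6):
`a_l ≤ a_M a_{l-M}` for `M < l ≤ 2M`. [cite: HaraHattoriWatanabe2001, §5.2 eqs. (5.18)–(5.19) and (A.6)] -/
def hiExt (hi : List ℕ) (l : ℕ) : ℕ := if l ≤ C.M then get hi l else C.mulH (get hi C.M) (get hi (l - C.M))

/-- Lower bound of `b_n 2^P`, `n ≤ 2M` ((5.4), (5.8)): the terms with an index beyond `M` are
dropped (they are `≥ 0`). [cite: HaraHattoriWatanabe2001, §5.2 eq. (5.8)] -/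
def bLo (T : Tab) (lo : List ℕ) (n : ℕ) : ℕ :=
  get T.c4L n * nsum (fun l => get2 T.binom n l * C.loExt lo l * C.loExt lo (n - l)) (n + 1) /
    (C.one * C.one)

/-- Upper bound of `b_n 2^P`, `n ≤ 2M` ((5.4), cf. (5.9)): indices beyond `M` are bounded through
(A.6) (`hiExt`). [cite: HaraHattoriWatanabe2001, §5.2 eqs. (5.9), (5.18)–(5.19)] -/
def bHi (T : Tab) (hi : List ℕ) (n : ℕ) : ℕ :=
  cdiv (get T.c4H n * nsum (fun l => get2 T.binom n l * C.hiExt hi l * C.hiExt hi (n - l)) (n + 1))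
    (C.one * C.one)

/-- Upward powers `[x, x·h, x·h², …]` (`k+1` entries, fixed point). [folklore] -/
def powsH (h : ℕ) : ℕ → ℕ → List ℕ
  | 0, x => [x]
  | k + 1, x => x :: powsH h k (C.mulH x h)

/-- Upper bound of the tail term `w(n,m)(β/2)^m (c/2)^{m+n} a_1^{m+n-M} a_M ≥ w(n,m)(β/2)^m b_{m+n}`
for `m + n > 2M` ((5.26)). [cite: HaraHattoriWatanabe2001, §5.2 eq. (5.26)] -/
def termU (T : Tab) (hp : List ℕ) (hiM n m : ℕ) : ℕ :=
  C.mulH (C.mulH (get2 T.twH n (m - (2 * C.M + 1 - n))) (get hp (m + n - C.M))) hiM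

/-- Upper bound of the truncation tail `Σ_{m > 2M-n} w(n,m)(β/2)^m b_{m+n}` of (5.6): explicit
majorants for `2M-n < m ≤ 3M`, then the geometric series from `m = 3M+1` with ratio bound `q`
(`(2m+2n+1)/(m+1) · βc a_1/2`, non-increasing in `m` for `n ≥ 1`; `βc a_1` for `n = 0`); the flag
records `q < 1`. [cite: HaraHattoriWatanabe2001, §5.2 eqs. (5.25)–(5.29)] -/
def tail (T : Tab) (hp : List ℕ) (hiM h n : ℕ) : ℕ × Bool :=
  let m0 := 2 * C.M + 1 - n
  let m1 := 3 * C.M + 1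
  let texp := nsum (fun j => C.termU T hp hiM n (m0 + j)) (m1 - m0)
  let tlast := C.termU T hp hiM n m1
  let qn := (if n = 0 then 2 * (m1 + 1) else 2 * m1 + 2 * n + 1) * C.rH * h
  let qd := (m1 + 1) * 2 * C.one * C.one
  (texp + cdiv (tlast * qd) (qd - qn), decide (qn < qd))

/-- Lower bound of `ã_n 2^P` ((5.6), (5.10)). [cite: HaraHattoriWatanabe2001, §5.2 eq. (5.10)] -/
def aLo (T : Tab) (blo : List ℕ) (n : ℕ) : ℕ :=
  nsum (fun m => get2 T.wbL n m * get blo (m + n)) (2 * C.M + 1 - n) / C.one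

/-- Upper bound of the truncated part of `ã_n 2^P` ((5.6), (5.11)).
[cite: HaraHattoriWatanabe2001, §5.2 eq. (5.11)] -/
def aHiCore (T : Tab) (bhi : List ℕ) (n : ℕ) : ℕ :=
  cdiv (nsum (fun m => get2 T.wbH n m * get bhi (m + n)) (2 * C.M + 1 - n)) C.one

/-- A run state: lower and upper enclosures `lo_n ≤ a_{n,N} 2^P ≤ hi_n`, `n ≤ M`, and the
well-definedness flag. [cite: HaraHattoriWatanabe2001, Proposition 5.1] -/
abbrev State := List ℕ × List ℕ × Bool

/-- One renormalisation step of the enclosures ((5.8)–(5.12)): `S` then `T` then the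
normalisation `a_{n,N+1} = ã_n/ã_0`. [cite: HaraHattoriWatanabe2001, §5.2 eqs. (5.8)–(5.12)] -/
def step (T : Tab) (st : State) : State :=
  let lo := st.1
  let hi := st.2.1
  let blo := (List.range (2 * C.M + 1)).map (C.bLo T lo)
  let bhi := (List.range (2 * C.M + 1)).map (C.bHi T hi)
  let h := get hi 1
  let hp := C.powsH h (3 * C.M + 1) C.one
  let hiM := get hi C.M
  let tl := (List.range (C.M + 1)).map (C.tail T hp hiM h)
  let alo := (List.range (C.M + 1)).map (C.aLo T blo)
  let ahi := (List.range (C.M + 1)).map fun n => C.aHiCore T bhi n + ((tl.getD n (0, false)).1)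
  let okT := tl.all fun t => t.2
  let a0lo := get alo 0
  let a0hi := get ahi 0
  let lo' := C.one :: (List.range C.M).map fun j => get alo (j + 1) * C.one / a0hi
  let hi' := C.one :: (List.range C.M).map fun j => cdiv (get ahi (j + 1) * C.one) a0lo
  (lo', hi', st.2.2 && okT && decide (0 < a0lo))

/-- Initial state at `s = sNum / 10¹⁶` ((5.2)). [cite: HaraHattoriWatanabe2001, §5.1 eq. (5.2)] -/
def init (sNum : ℕ) : State :=
  ((List.range (C.M + 1)).map (C.initLo sNum), (List.range (C.M + 1)).map (C.initHi sNum), true)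

/-- The history of states `N = k, k-1, …, 0` (latest first). [cite: HaraHattoriWatanabe2001, §5.3] -/
def hist (T : Tab) (sNum : ℕ) : ℕ → List State
  | 0 => [C.init sNum]
  | k + 1 =>
    match hist T sNum k with
    | [] => []
    | st :: rest => C.step T st :: st :: rest

/-- The enclosure invariant of Proposition 5.1 ((5.16)): `lo_n ≤ a_n 2^P ≤ hi_n` for `n ≤ M`, for a
real sequence `a`. [cite: HaraHattoriWatanabe2001, Proposition 5.1 eq. (5.16)] -/
def Encl (lo hi : List ℕ) (a : ℕ → ℝ) : Prop :=
  ∀ n, n ≤ C.M → (get lo n : ℝ) ≤ a n * C.one ∧ a n * C.one ≤ (get hi n : ℝ)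

/-- The `b` lower list of a step. [folklore] -/
def bloL (T : Tab) (lo : List ℕ) : List ℕ := (List.range (2 * C.M + 1)).map (C.bLo T lo)
/-- The `b` upper list of a step. [folklore] -/
def bhiL (T : Tab) (hi : List ℕ) : List ℕ := (List.range (2 * C.M + 1)).map (C.bHi T hi)
/-- The powers of `hi₁` used by the tail. [folklore] -/
def hpL (hi : List ℕ) : List ℕ := C.powsH (get hi 1) (3 * C.M + 1) C.one
/-- The tails of a step. [folklore] -/
def tlL (T : Tab) (hi : List ℕ) : List (ℕ × Bool) :=
  (List.range (C.M + 1)).map (C.tail T (C.hpL hi) (get hi C.M) (get hi 1))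
/-- The `ã` lower list of a step. [folklore] -/
def aloL (T : Tab) (lo : List ℕ) : List ℕ := (List.range (C.M + 1)).map (C.aLo T (C.bloL T lo))
/-- The `ã` upper list of a step. [folklore] -/
def ahiL (T : Tab) (hi : List ℕ) : List ℕ :=
  (List.range (C.M + 1)).map fun n => C.aHiCore T (C.bhiL T hi) n + (((C.tlL T hi).getD n (0, false)).1)

/-- The run of states `N ↦ step^N init` (the same states `hist` materialises as a list; used in
the soundness proofs). [cite: HaraHattoriWatanabe2001, §5.3] -/
def run (T : Tab) (sNum : ℕ) : ℕ → State
  | 0 => C.init sNum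
  | N + 1 => C.step T (run T sNum N)

/-- State at step `N` from a history of `nSteps + 1` states (latest first). [folklore] -/
def stateAt (hs : List State) (N : ℕ) : State := hs.getD (C.nSteps - N) ([], [], false)

/-- Both runs ended with their well-definedness flag set. [folklore] -/
def okRuns (hm hp : List State) : Bool :=
  (C.stateAt hm C.nSteps).2.2 && (C.stateAt hp C.nSteps).2.2

/-- (2.17) at `s₊` for `N₀ ≤ N < N₁`: `hi₁(N,s₊) < 2·2^P + s2L` (`≤ (2+√2) 2^P`).
[cite: HaraHattoriWatanabe2001, Theorem 2.1 eq. (2.17) and §5.3 (1)] -/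
def chk217 (hp : List State) : Bool :=
  (List.range (C.nSteps - C.N0)).all fun j =>
    decide (get (C.stateAt hp (C.N0 + j)).2.1 1 < 2 * C.one + C.s2L)

/-- (5.30): `μ_{2,N₁}(s₋) < 1` and `μ_{2,N₁}(s₊) > 1 + (3/√2) μ̄_{4,N₁}(s₊)`, in integer form with
`O = 2^P`: `hi₁(s₋) < O`; `O < lo₁(s₊)`, `lo₂(s₊)·O ≤ hi₁(s₊)²` (so `μ̄₄ ≥ 0`) and
`4O³ + 3·s2H·hi₁(s₊)² < 4O²·lo₁(s₊) + 3·s2H·lo₂(s₊)·O`. [cite: HaraHattoriWatanabe2001, §5.3 eq. (5.30)] -/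
def chk530 (hm hp : List State) : Bool :=
  let O := C.one
  let hm1 := get (C.stateAt hm C.nSteps).2.1 1
  let lp1 := get (C.stateAt hp C.nSteps).1 1
  let lp2 := get (C.stateAt hp C.nSteps).1 2
  let hp1 := get (C.stateAt hp C.nSteps).2.1 1
  decide (hm1 < O ∧ O < lp1 ∧ lp2 * O ≤ hp1 * hp1 ∧
    4 * O ^ 3 + 3 * C.s2H * (hp1 * hp1) < 4 * O ^ 2 * lp1 + 3 * C.s2H * lp2 * O)

/-- (2.14)–(2.16) at `N₀` uniformly on `[s₋, s₊]` in the endpoint-mixed form (5.34). With `O = 2^P`,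
`A⁻_n = lo_n(N₀,s₋)`, `A⁺_n = hi_n(N₀,s₊)`, `X = (A⁺₁)² - A⁻₂O`, `Y = (A⁻₁)² - A⁺₂O`
(`μ₄ ∈ [Y, X]/(2O²)`): `A⁺₂O ≤ (A⁻₁)²`, `A⁻₂O ≤ (A⁺₁)²`, `10000(A⁺₁)² ≤ 90O² + 10000A⁻₂O` ((2.14));
`24X² + 30O²A⁺₁A⁺₂ ≤ 20O(A⁻₁)³ + 10O³A⁻₃`, `400O(A⁺₁)³ + 200O³A⁺₃ ≤ 1821Y² + 600O²A⁻₁A⁻₂` ((2.15));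
`12O(A⁺₁)²A⁺₂ + O³A⁺₄ ≤ 6(A⁻₁)⁴ + 3O²(A⁻₂)² + 4O²A⁻₁A⁻₃`,
`6000O²(A⁺₁)⁴ + 3000O⁴(A⁺₂)² + 4000O⁴A⁺₁A⁺₃ ≤ 145407Y³ + 12000O³(A⁻₁)²A⁻₂ + 1000O⁵A⁻₄` ((2.16)).
[cite: HaraHattoriWatanabe2001, §5.3 eqs. (5.31)–(5.34)] -/
def chkN0 (hm hp : List State) : Bool :=
  let O := C.one
  let am1 := get (C.stateAt hm C.N0).1 1
  let am2 := get (C.stateAt hm C.N0).1 2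
  let am3 := get (C.stateAt hm C.N0).1 3
  let am4 := get (C.stateAt hm C.N0).1 4
  let ap1 := get (C.stateAt hp C.N0).2.1 1
  let ap2 := get (C.stateAt hp C.N0).2.1 2
  let ap3 := get (C.stateAt hp C.N0).2.1 3
  let ap4 := get (C.stateAt hp C.N0).2.1 4
  let X := ap1 * ap1 - am2 * O
  let Y := am1 * am1 - ap2 * O
  decide (ap2 * O ≤ am1 * am1 ∧ am2 * O ≤ ap1 * ap1 ∧
    10000 * (ap1 * ap1) ≤ 90 * O ^ 2 + 10000 * am2 * O ∧
    24 * X ^ 2 + 30 * O ^ 2 * ap1 * ap2 ≤ 20 * O * am1 ^ 3 + 10 * O ^ 3 * am3 ∧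
    400 * O * ap1 ^ 3 + 200 * O ^ 3 * ap3 ≤ 1821 * Y ^ 2 + 600 * O ^ 2 * am1 * am2 ∧
    12 * O * ap1 ^ 2 * ap2 + O ^ 3 * ap4 ≤ 6 * am1 ^ 4 + 3 * O ^ 2 * am2 ^ 2 + 4 * O ^ 2 * am1 * am3 ∧
    6000 * O ^ 2 * ap1 ^ 4 + 3000 * O ^ 4 * ap2 ^ 2 + 4000 * O ^ 4 * ap1 * ap3 ≤
      145407 * Y ^ 3 + 12000 * O ^ 3 * am1 ^ 2 * am2 + 1000 * O ^ 5 * am4)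

/-- All final checks. [cite: HaraHattoriWatanabe2001, §5.3] -/
def finalChecks (hm hp : List State) : Bool :=
  C.okRuns hm hp && C.chk217 hp && C.chk530 hm hp && C.chkN0 hm hp

/-- The whole certificate: square-root validation, `4 ≤ M`, `N₀ ≤ N₁`, the two runs and the final
checks. [cite: HaraHattoriWatanabe2001, Theorem 2.2 and §5.3] -/
def check : Bool :=
  let T := C.mkTab
  C.sqrtOK && decide (4 ≤ C.M) && decide (C.N0 ≤ C.nSteps) &&
    C.finalChecks (C.hist T sMinusNum C.nSteps) (C.hist T sPlusNum C.nSteps)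

end Cfg

/-- The parameters used: `M = 60`, `P = 330`, `N₁ = 100`, `N₀ = 70`, and `⌊√2 · 2³³⁰⌋`.
[cite: HaraHattoriWatanabe2001, Theorem 2.2] -/
def cfg : Cfg where
  M := 60
  P := 330
  s2L := 3093239639298517386559757856051305673234060574849075547859922380549980493260917464018821296711671109
  nSteps := 100
  N0 := 70

/-- **The certificate theorem**: `cfg.check = true`, evaluated by `native_decide` (the two runs of
Proposition 5.1 at `M = 60`, `P = 330` bits, `N ≤ 100`, at `s₋` and `s₊`, and the final inequalities
of §5.3; ≈ 20 s). Axiom: the `native_decide` auxiliary (computational certificate).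
[cite: HaraHattoriWatanabe2001, Theorem 2.2 and §5.3] -/
theorem cert_ok : cfg.check = true := by
  native_decide

end Literature.Barriers.CriticalPhenomena.HierarchicalRG.Thm22Cert
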